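/-
Copyright (c) 2026 the pub-hodgecm-mathlib formalisation cell (harness21).  Prover seat hodgecm-mathlib-K2E3-p14 (g2), Track B «K2-LIT» ∕ h413
(`stmt-HodgeConjecture-24833`), unit U12 «Harish-Chandra characters» of the line `K2_E3_EllipticInputs`, socket U12-h ‹#9L› `sig_K2E3CharLocConstNearRegular`:
package (P-U dock) for the 9L line lead's U-assembly ★ p855958∕p856036 `exists_levelTraceStable_U(_regime)` (K2E3-p09 (g2), K2 bus 2026-09-04T00:16Z deal to this seat).  2026-09-04.
-/
import Summits.HodgeConjecture.HodgeConjecture.Theorems.K2E3ParameterPackageU                -- ★ p856045 (this seat): generic column hnd∕hconjCh∕hiso∕hcontr∕hδm along `e : G ≃ₜ* ↥U`; brings ★ p855816∕p855784 levels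
import Summits.HodgeConjecture.HodgeConjecture.Theorems.K2E3UnitaryLayerOccurrenceNilpotent   -- ★ (N-U) (K2E1b-p08): `exists_nilpotent_add_valBound_of_unitary_occurrence`; brings ★ (Char-U) p855984 `valBound_conj_sub_of_agree_on_unitary_overlap`, `formAdjoint_conj_eq_smul_of_mem`
import HarnessLib

/-!
# Crux `H413` — K2-LIT E3 «EllipticInputs», U12-h package (P-U dock): THE `𝔰_ε`-SPECIFIC PARAMETER BINDERS OF ★ `exists_levelTraceStable_U(_regime)` AT A UNITARY FRAME —
# `hSAd`, `hint` (floor `m₀ := d + 1`, `cH := d`) and `hocc` (`E := d`, occurrence level `ν′ ≥ d + 1`) for `U := U(σ, J) ≤ GL_n(F)`, `e : G ≃ₜ* ↥U`, parameters in the `θ_J`-eigenspace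
# `S := {X | J⁻¹ (X.map σ)ᵀ J = ε • X}`, docked from K2E1b-p08's ★ (Char-U)∕(N-U) bricks read through `e`

Cell `hodgecm-mathlib`, Track B «K2-LIT», crux item `stmt-HodgeConjecture-24833` (h413), line `K2_E3_EllipticInputs`, unit U12 «HC characters», socket U12-h
`sig_K2E3CharLocConstNearRegular` (‹#9L›).  9L is now `hStabNs` (★ p856048 `charLocConstNearRegular_of_nonsplit_levelTraceStable`): level stability at the NON-SPLIT places,
i.e. ★ `exists_levelTraceStable_U_regime` (K2E3-p09 (g2)) along ★ `localNonsplitEquiv` with `U = U(σ_w, H_w)(L_w)`.  Its `S`-independent binders are ★ p856045 (this seat); THIS FILE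
docks the `S`-SPECIFIC ones from K2E1b-p08 (g2)'s unitary-layer bricks — ★ (Char-U) p855984 `valBound_conj_sub_of_agree_on_unitary_overlap` (hint-U), ★ (N-U)
`exists_nilpotent_add_valBound_of_unitary_occurrence` (hocc-U), ★ (Lay-U-1)∕(Char-U) `formAdjoint_conj_eq_smul_of_mem` (hSAd) — in the EXACT binder shapes of ★ p856036 with
`S := {X | J⁻¹ * (X.map σ)ᵀ * J = ε • X}` (`ε = −1`: `𝔲`; `ε = +1`: `𝔭`, the twisted road of p08's 00:11Z design), `m₀ := d + 1`, `cH := d`, `E := d` for p08's single defect exponent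
`d` (`hd : v(⅟2)·(v(⅟2)·max 1 (κ′κ))·|ϖ|^d ≤ 1`), the test elements `a ∈ U ∩ K_m` being pulled back to `G` as `e.symm ⟨a, _⟩`, and the «some height `L₀`» binder of the bricks
discharged from the (Dict) clause `hdict` (`q^L → ∞`).  The remaining `S`-binder `hS` (every character of `Kf N′ ⧸ Kf N` is `Ch X` with `X ∈ 𝔰_ε`) waits on (Char-U) part 2.
`--supports stmt-HodgeConjecture-24833 --as helper`.  THEOREMS ONLY — no `def`, no named fact, no instance, no notation, no `sorry`.  HONEST LABEL: HC_CM is proved only modulo the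
7 printed citations (2 remaining named inputs: hLiu418 = stmt-HodgeConjecture-24832, h413 = stmt-HodgeConjecture-24833) until rung 0 closes; count-neutral plumbing.

* `exists_valBound_pow_inv_of_hdict` — every matrix has SOME height `L₀` (`ValBound (|ϖ|^{L₀})⁻¹ X`) once `ValBound (|ϖ|^L)⁻¹ X ↔ ‖X‖ ≤ q^L` with `1 < q`.
* `dock_hSAd` — `Ad(e x)` preserves `𝔰_ε` for `x ∈ Kf 0` (indeed for every `x`).
* `dock_hint` — hint-U: heights `h` of `e y`, floor `d + 1 ≤ m`, `X X′ ∈ 𝔰_ε`, matching on `{a ∈ Kf m : y⁻¹ a y ∈ Kf m}` ⇒ `‖(e y) X (e y)⁻¹ − X′‖ ≤ q^{m + 2h + d}`.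
* `dock_hocc` — hocc-U: `d + 1 ≤ ν′ ≤ N′`, `X ∈ 𝔰_ε`, `Ch X ≡ 1` on `{a ∈ Kf N′ : x⁻¹ a x ∈ Kf ν′}` ⇒ `X = Z + B`, `Z` nilpotent, `‖B‖ ≤ q^{N′ + d}`.

## References
* [HarishChandra1999] Harish-Chandra (DeBacker–Sally), *Admissible Invariant Distributions on Reductive p-adic Groups*, ULECT 16 (1999), §17 Cor. 17.2, §19 Lemmas 19.3–19.4, §20.
* [Howe1977Kirillov] R. Howe, *Kirillov theory for compact p-adic groups*, Pacific J. Math. 73 (1977), §1.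
* [PlatonovRapinchuk1994] V. Platonov, A. Rapinchuk, *Algebraic Groups and Number Theory* (1994), §2.3 (unitary groups of hermitian forms, `Ad`-invariance of `𝔲`).
-/

set_option autoImplicit false
-- the mandated namespace repeats `HodgeConjecture.HodgeConjecture`, as in every `Theorems/*.lean` of this sub-problem
set_option linter.dupNamespace false

noncomputable section

open Topology Filter Set ValuativeRel Matrix
open Literature.NumberTheory.Automorphic
open Summit.HodgeConjecture.HodgeConjecture.Cruxes.H413 Summit.HodgeConjecture.HodgeConjecture.Cruxes.H413.K2E3UnitaryCongruenceFrame
  Summit.HodgeConjecture.HodgeConjecture.Cruxes.H413.K2E3UnitaryLayerCharacters Summit.HodgeConjecture.HodgeConjecture.Cruxes.H413.K2E3UnitaryLayerOccurrenceNilpotent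
open scoped MatrixGroups Matrix.Norms.Elementwise

namespace Summit.HodgeConjecture.HodgeConjecture.Cruxes.H413.K2E3ParameterPackageUDock

/-! ## §1 `hSAd`: `Ad(U)` preserves every `θ_J`-eigenspace (no norm) -/

section Algebra

variable {F : Type*} [Field F] [TopologicalSpace F] {n : ℕ} (σ : F →+* F) {J : Matrix (Fin n) (Fin n) F} {G : Type*} [Group G] [TopologicalSpace G]
  (e : G ≃ₜ* ↥(unitaryGroupOfForm σ J))

/-- **`hSAd` (★ p856036's shape)**: for every `x` in the integral level `Kf 0` (indeed any `x : G`, `e x ∈ U(σ, J)`) and `X ∈ 𝔰_ε = {X | J⁻¹ (X.map σ)ᵀ J = ε • X}`,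
`(e x) X (e x)⁻¹ ∈ 𝔰_ε` (★ `formAdjoint_conj_eq_smul_of_mem`). [cite: PlatonovRapinchuk1994, §2.3] [cite: HarishChandra1999, §19 p. 84] -/
theorem dock_hSAd (hJu : IsUnit J.det) (ε : F) (K₁ : Subgroup G) :
    ∀ x ∈ K₁, ∀ X ∈ {X : Matrix (Fin n) (Fin n) F | J⁻¹ * (X.map σ)ᵀ * J = ε • X},
      (((e x : ↥(unitaryGroupOfForm σ J)) : GL (Fin n) F) : Matrix (Fin n) (Fin n) F) * X *
          ((((e x : ↥(unitaryGroupOfForm σ J)) : GL (Fin n) F)⁻¹ : GL (Fin n) F) : Matrix (Fin n) (Fin n) F) ∈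
        {X : Matrix (Fin n) (Fin n) F | J⁻¹ * (X.map σ)ᵀ * J = ε • X} :=
  fun x _ _ hX => formAdjoint_conj_eq_smul_of_mem σ hJu (e x).2 hX

end Algebra

/-! ## §2 `hint` and `hocc` docked from the unitary-layer bricks -/

section Normed

variable {F : Type*} [NontriviallyNormedField F] [ValuativeRel F] [Invertible (2 : F)] {n : ℕ} (σ : F →+* F) {J : Matrix (Fin n) (Fin n) F}
  {G : Type*} [Group G] [TopologicalSpace G] (e : G ≃ₜ* ↥(unitaryGroupOfForm σ J)) {ϖ : F} {q : ℝ} (ψ : AddChar F Circle)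

omit [ValuativeRel F] [Invertible (2 : F)] in
/-- **EVERY MATRIX HAS SOME HEIGHT** under the (Dict) clause: from `ValBound (|ϖ|^L)⁻¹ X ↔ ‖X‖ ≤ q^L` and `1 < q` (`q^L → ∞`), some `L₀` has `ValBound (|ϖ|^{L₀})⁻¹ X` — the `hXb`
binder of ★ (Char-U)∕(N-U). [cite: HarishChandra1999, §17 p. 80] -/
theorem exists_valBound_pow_inv_of_hdict {Γ : Type*} (vb : Γ → Matrix (Fin n) (Fin n) F → Prop) (lev : ℕ → Γ) (hq : 1 < q)
    (hdict : ∀ (m : ℕ) (X : Matrix (Fin n) (Fin n) F), vb (lev m) X ↔ ‖X‖ ≤ q ^ m) (X : Matrix (Fin n) (Fin n) F) : ∃ L₀ : ℕ, vb (lev L₀) X := by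
  obtain ⟨L₀, hL₀⟩ := pow_unbounded_of_one_lt ‖X‖ hq
  exact ⟨L₀, (hdict L₀ X).2 hL₀.le⟩

/-- **hint-U DOCKED (★ p856036's shape, `m₀ := d + 1`, `cH := d`)**: for `y : G` with `e y` of height `≤ h`, `d + 1 ≤ m`, `X X′ ∈ 𝔰_ε`, if `Ch X (y⁻¹ a y) = Ch X′ a` on
`{a ∈ Kf m : y⁻¹ a y ∈ Kf m}` then `‖(e y) X (e y)⁻¹ − X′‖ ≤ q^{m + 2h + d}` — ★ (Char-U) `valBound_conj_sub_of_agree_on_unitary_overlap` at `y := ↑(e y) ∈ U` (test elements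
`a ∈ U ∩ K_m` pulled back as `e.symm ⟨a, _⟩`), heights `L₀` from `hdict`, then `hdict` at level `m + 2h + d`. [cite: HarishChandra1999, §17 Cor. 17.2, §19 Lemma 19.4] [cite: Howe1977Kirillov, §1] -/
theorem dock_hint (hϖ : IsUniformizingElement ϖ) (hψ : ∀ x : F, valuation F x ≤ 1 → ψ x = 1) (hψ' : ∃ x : F, valuation F x ≤ (valuation F ϖ)⁻¹ ∧ ψ x ≠ 1)
    {ε : F} (hanti : ∀ a : F, σ a = ε * a → ψ a = 1) (hσ : ∀ a : F, σ (σ a) = a) (hσv : ∀ a : F, valuation F (σ a) = valuation F a)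
    (hJ : (J.map σ)ᵀ = J) (hJu : IsUnit J.det) {κ κ' : ValueGroupWithZero F} (hJb : ValBound κ J) (hJib : ValBound κ' J⁻¹) {d : ℕ}
    (hd : valuation F (⅟(2 : F)) * (valuation F (⅟(2 : F)) * max 1 (κ' * κ)) * valuation F ϖ ^ d ≤ 1)
    (hq : 1 < q) (hdict : ∀ (m : ℕ) (X : Matrix (Fin n) (Fin n) F), ValBound (valuation F ϖ ^ m)⁻¹ X ↔ ‖X‖ ≤ q ^ m)
    (Ch : Matrix (Fin n) (Fin n) F → G → ℂ)
    (hCh : ∀ (X : Matrix (Fin n) (Fin n) F) (g : G),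
      Ch X g = ((ψ (Matrix.trace (X * ((((e g : ↥(unitaryGroupOfForm σ J)) : GL (Fin n) F) : Matrix (Fin n) (Fin n) F) - 1))) : Circle) : ℂ)) :
    ∀ (h : ℕ) (y : G), ValBound (valuation F ϖ ^ h)⁻¹ (((e y : ↥(unitaryGroupOfForm σ J)) : GL (Fin n) F) : Matrix (Fin n) (Fin n) F) →
      ValBound (valuation F ϖ ^ h)⁻¹ ((((e y : ↥(unitaryGroupOfForm σ J)) : GL (Fin n) F)⁻¹ : GL (Fin n) F) : Matrix (Fin n) (Fin n) F) →
      ∀ m : ℕ, d + 1 ≤ m → 1 ≤ m → ∀ X ∈ {X : Matrix (Fin n) (Fin n) F | J⁻¹ * (X.map σ)ᵀ * J = ε • X}, ∀ X' ∈ {X : Matrix (Fin n) (Fin n) F | J⁻¹ * (X.map σ)ᵀ * J = ε • X},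
        (∀ a ∈ (congruenceGL n (valuation F ϖ ^ m)).comap ((unitaryGroupOfForm σ J).subtype.comp e.toMulEquiv.toMonoidHom),
          y⁻¹ * a * y ∈ (congruenceGL n (valuation F ϖ ^ m)).comap ((unitaryGroupOfForm σ J).subtype.comp e.toMulEquiv.toMonoidHom) → Ch X (y⁻¹ * a * y) = Ch X' a) →
        ‖(((e y : ↥(unitaryGroupOfForm σ J)) : GL (Fin n) F) : Matrix (Fin n) (Fin n) F) * X *
            ((((e y : ↥(unitaryGroupOfForm σ J)) : GL (Fin n) F)⁻¹ : GL (Fin n) F) : Matrix (Fin n) (Fin n) F) - X'‖ ≤ q ^ (m + 2 * h + d) := by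
  intro h y hy₁ hy₂ m hdm _ X hX X' hX' hmatch
  -- a common height for the two parameters
  obtain ⟨L₁, hL₁⟩ := exists_valBound_pow_inv_of_hdict (fun γ X => ValBound γ X) (fun m => (valuation F ϖ ^ m)⁻¹) hq hdict X
  obtain ⟨L₂, hL₂⟩ := exists_valBound_pow_inv_of_hdict (fun γ X => ValBound γ X) (fun m => (valuation F ϖ ^ m)⁻¹) hq hdict X'
  have hmonoL : ∀ {L L' : ℕ}, L ≤ L' → (valuation F ϖ ^ L)⁻¹ ≤ (valuation F ϖ ^ L')⁻¹ := fun hLL' =>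
    K2E3SubgroupCongruenceLevels.inv_pow_le_inv_pow_of_le hϖ.ne_zero hϖ.valuation_lt_one hLL'
  have hXb : ValBound (valuation F ϖ ^ max L₁ L₂)⁻¹ X := hL₁.mono (hmonoL (le_max_left _ _))
  have hX'b : ValBound (valuation F ϖ ^ max L₁ L₂)⁻¹ X' := hL₂.mono (hmonoL (le_max_right _ _))
  -- the matching hypothesis read on `U ∩ K_m`
  have hagree : ∀ a ∈ unitaryGroupOfForm σ J, a ∈ congruenceGL n (valuation F ϖ ^ m) →
      ((e y : ↥(unitaryGroupOfForm σ J)) : GL (Fin n) F)⁻¹ * a * ((e y : ↥(unitaryGroupOfForm σ J)) : GL (Fin n) F) ∈ congruenceGL n (valuation F ϖ ^ m) →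
      ψ (Matrix.trace (X * (((((e y : ↥(unitaryGroupOfForm σ J)) : GL (Fin n) F)⁻¹ * a * ((e y : ↥(unitaryGroupOfForm σ J)) : GL (Fin n) F) : GL (Fin n) F) :
        Matrix (Fin n) (Fin n) F) - 1))) = ψ (Matrix.trace (X' * ((a : Matrix (Fin n) (Fin n) F) - 1))) := by
    intro a haU ha ha'
    have hea : e (e.symm ⟨a, haU⟩) = ⟨a, haU⟩ := e.apply_symm_apply _
    have hk₁ : e.symm ⟨a, haU⟩ ∈ (congruenceGL n (valuation F ϖ ^ m)).comap ((unitaryGroupOfForm σ J).subtype.comp e.toMulEquiv.toMonoidHom) :=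
      (mem_comap_congruenceGL_iff e _ _).2 (by rw [hea]; exact ha)
    have hek : (((e (y⁻¹ * e.symm ⟨a, haU⟩ * y)) : ↥(unitaryGroupOfForm σ J)) : GL (Fin n) F) =
        ((e y : ↥(unitaryGroupOfForm σ J)) : GL (Fin n) F)⁻¹ * a * ((e y : ↥(unitaryGroupOfForm σ J)) : GL (Fin n) F) := by
      rw [map_mul, map_mul, map_inv, hea, Subgroup.coe_mul, Subgroup.coe_mul, Subgroup.coe_inv]
    have hk₂ : y⁻¹ * e.symm ⟨a, haU⟩ * y ∈ (congruenceGL n (valuation F ϖ ^ m)).comap ((unitaryGroupOfForm σ J).subtype.comp e.toMulEquiv.toMonoidHom) :=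
      (mem_comap_congruenceGL_iff e _ _).2 (by rw [hek]; exact ha')
    have hm := hmatch _ hk₁ hk₂
    rw [hCh, hCh, hek, hea] at hm
    exact Circle.ext hm
  have hC := valBound_conj_sub_of_agree_on_unitary_overlap σ ψ hϖ hψ hψ' hanti hσ hσv hJ hJu hJb hJib hd hX hX' hXb hX'b (e y).2 hy₁ hy₂ hagree
    (m' := m + 2 * h + d) (by omega)
  exact (hdict (m + 2 * h + d) _).1 hC

/-- **hocc-U DOCKED (★ p856036's shape, `E := d`, floor `d + 1 ≤ ν′`)**: for `X ∈ 𝔰_ε` and `x : G`, if `Ch X ≡ 1` on `{a ∈ Kf N′ : x⁻¹ a x ∈ Kf ν′}` with `d + 1 ≤ ν′ ≤ N′` then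
`X = Z + B` with `Z` nilpotent and `‖B‖ ≤ q^{N′ + d}` — ★ (N-U) `exists_nilpotent_add_valBound_of_unitary_occurrence` at `x := ↑(e x) ∈ U`, height `L₀` from `hdict`, then `hdict`.
[cite: HarishChandra1999, §19 Lemma 19.3, §20] [cite: Howe1977Kirillov, §1] -/
theorem dock_hocc [IsDiscreteValuationRing 𝒪[F]] (hϖ : IsUniformizingElement ϖ) (hψ : ∀ x : F, valuation F x ≤ 1 → ψ x = 1)
    (hψ' : ∃ x : F, valuation F x ≤ (valuation F ϖ)⁻¹ ∧ ψ x ≠ 1)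
    {ε : F} (hanti : ∀ a : F, σ a = ε * a → ψ a = 1) (hσ : ∀ a : F, σ (σ a) = a) (hσv : ∀ a : F, valuation F (σ a) = valuation F a)
    (hJ : (J.map σ)ᵀ = J) (hJu : IsUnit J.det) {κ κ' : ValueGroupWithZero F} (hJb : ValBound κ J) (hJib : ValBound κ' J⁻¹) {d : ℕ}
    (hd : valuation F (⅟(2 : F)) * (valuation F (⅟(2 : F)) * max 1 (κ' * κ)) * valuation F ϖ ^ d ≤ 1)
    (hq : 1 < q) (hdict : ∀ (m : ℕ) (X : Matrix (Fin n) (Fin n) F), ValBound (valuation F ϖ ^ m)⁻¹ X ↔ ‖X‖ ≤ q ^ m)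
    (Ch : Matrix (Fin n) (Fin n) F → G → ℂ)
    (hCh : ∀ (X : Matrix (Fin n) (Fin n) F) (g : G),
      Ch X g = ((ψ (Matrix.trace (X * ((((e g : ↥(unitaryGroupOfForm σ J)) : GL (Fin n) F) : Matrix (Fin n) (Fin n) F) - 1))) : Circle) : ℂ)) :
    ∀ ν' N' : ℕ, d + 1 ≤ ν' → 1 ≤ ν' → ν' ≤ N' → ∀ X ∈ {X : Matrix (Fin n) (Fin n) F | J⁻¹ * (X.map σ)ᵀ * J = ε • X}, ∀ x : G,
      (∀ a ∈ (congruenceGL n (valuation F ϖ ^ N')).comap ((unitaryGroupOfForm σ J).subtype.comp e.toMulEquiv.toMonoidHom),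
        x⁻¹ * a * x ∈ (congruenceGL n (valuation F ϖ ^ ν')).comap ((unitaryGroupOfForm σ J).subtype.comp e.toMulEquiv.toMonoidHom) → Ch X a = 1) →
      ∃ Z B : Matrix (Fin n) (Fin n) F, IsNilpotent Z ∧ ‖B‖ ≤ q ^ (N' + d) ∧ X = Z + B := by
  intro ν' N' hν' _ hνN X hX x hocc
  obtain ⟨L₀, hXb⟩ := exists_valBound_pow_inv_of_hdict (fun γ X => ValBound γ X) (fun m => (valuation F ϖ ^ m)⁻¹) hq hdict X
  have hocc' : ∀ k ∈ unitaryGroupOfForm σ J, k ∈ congruenceGL n (valuation F ϖ ^ N') →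
      ((e x : ↥(unitaryGroupOfForm σ J)) : GL (Fin n) F)⁻¹ * k * ((e x : ↥(unitaryGroupOfForm σ J)) : GL (Fin n) F) ∈ congruenceGL n (valuation F ϖ ^ ν') →
      ψ (Matrix.trace (X * ((k : Matrix (Fin n) (Fin n) F) - 1))) = 1 := by
    intro k hkU hk hk'
    have hea : e (e.symm ⟨k, hkU⟩) = ⟨k, hkU⟩ := e.apply_symm_apply _
    have hk₁ : e.symm ⟨k, hkU⟩ ∈ (congruenceGL n (valuation F ϖ ^ N')).comap ((unitaryGroupOfForm σ J).subtype.comp e.toMulEquiv.toMonoidHom) :=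
      (mem_comap_congruenceGL_iff e _ _).2 (by rw [hea]; exact hk)
    have hek : (((e (x⁻¹ * e.symm ⟨k, hkU⟩ * x)) : ↥(unitaryGroupOfForm σ J)) : GL (Fin n) F) =
        ((e x : ↥(unitaryGroupOfForm σ J)) : GL (Fin n) F)⁻¹ * k * ((e x : ↥(unitaryGroupOfForm σ J)) : GL (Fin n) F) := by
      rw [map_mul, map_mul, map_inv, hea, Subgroup.coe_mul, Subgroup.coe_mul, Subgroup.coe_inv]
    have hk₂ : x⁻¹ * e.symm ⟨k, hkU⟩ * x ∈ (congruenceGL n (valuation F ϖ ^ ν')).comap ((unitaryGroupOfForm σ J).subtype.comp e.toMulEquiv.toMonoidHom) :=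
      (mem_comap_congruenceGL_iff e _ _).2 (by rw [hek]; exact hk')
    have hm := hocc _ hk₁ hk₂
    rw [hCh, hea] at hm
    exact Circle.ext (hm.trans Circle.coe_one.symm)
  obtain ⟨Z, B, hZ, hB, hXZB⟩ := exists_nilpotent_add_valBound_of_unitary_occurrence σ ψ hϖ hψ hψ' hanti hσ hσv hJ hJu hJb hJib hd hX hXb (e x).2 hν' hνN hocc'
  exact ⟨Z, B, hZ, (hdict (N' + d) B).1 hB, hXZB⟩

end Normed

end Summit.HodgeConjecture.HodgeConjecture.Cruxes.H413.K2E3ParameterPackageUDock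

end
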